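import Summits.HodgeConjecture.HodgeConjecture.Theorems.Ring2AbelianAllAndreWeilPencils
import HarnessLib

/-!
# Ring 2 · sub-cell AbelianAll (ALL ABELIAN VARIETIES), André axis, part VIII — ERRATUM AND REPAIR of the
# fibre-class (β-) Lefschetz node: part V's `FibreClassLefschetzFor` quantifies over ALL degrees `p` and is
# therefore REFUTABLE (no algebraic correspondence `H^{2p+2}(𝒳) → H^{2p}(𝒳)` exists in the tree's sense for
# `p ≥ d + 2`, by degree bookkeeping alone); the REPAIRED node `FibreClassLefschetzOn` bounds `p ≤ d`, and every
# edge and row of parts V and VII is re-proved for it (with the vanishing of `H^{2p}(𝒳_s)`, `p > d`, in the engine)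

HONEST FRAMING (page 1, verbatim): **research route, not a corollary; conditional on HC_CM plus one named
minimal statement.** Cell line: research route conditional on HC_CM; not a corollary; Q11.4-sentence-2
already refuted in dim ≥ 3. Nothing in this file proves a case of the Hodge conjecture. `HC_CM` =
`Theses.RankFourFaces.CMAbelianHodge` (a BINDER), `HC_AV` = `Theses.PadicSemiregularLift.HodgeAbelianVarieties`,
item `Theses.RankFourFaces.CMToAbelian` (stmt-16267) OPEN and not closed here. Seat `pub-hodge-ring2-ab-andre-2`,
gen 2 (self-audit of parts V–VII, same session).

## The erratum (refuted-misstated, by this seat, of its own node)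

`HodgeTheory.IsAlgebraicCorrespondence m n W X T` for `T : Hᵃ(X) → Hᵇ(W)` asks for natural numbers `e, q` with
`a + 2e = b + 2n` and `b + q = 2m`. For `T : H^{2(p+1)}(𝒳) → H^{2p}(𝒳)` on the `(d+1)`-fold `𝒳` this forces
`2p + q = 2(d+1)`, unsolvable for `p ≥ d + 2` — so NO such `T` is an algebraic correspondence in those (empty)
degrees, and part V's `FibreClassLefschetzFor hf := ∀ p, ∃ T, IsAlgebraicCorrespondence … T ∧ …` is FALSE for
every compact pencil (`not_fibreClassLefschetzFor`, three lines: `p := d + 2`, `omega`). Consequently the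
universal nodes (β∀) `FibreClassLefschetzCompactPencils`, (β) `FibreClassLefschetzCMPointedPencils`, (β)_d
`FibreClassLefschetzAtRelDim d` are refutable as soon as one (CM-pointed) compact abelian pencil (of relative
dimension `d`) is exhibited, and (β∃) `CMAnchoredPencilFibreClassLefschetz` as soon as one Hodge class on one
abelian variety is; all theorems of parts V–VII with these nodes as HYPOTHESES remain true but are VACUOUS. The
witness exploits only the missing degree bound — a misstatement, not a mathematical phenomenon: the intended
statement (Abdulali's Conjecture 5.3 / the base half of `B(𝒳)`) concerns the degrees `0 ≤ p ≤ d` in which the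
fibres have cohomology. REPAIRED STATEMENT (this file): `FibreClassLefschetzOn hf := ∀ p ≤ d, ∃ T …` (same body).
In the omitted degrees nothing is lost: for `p > d`, `H^{2p}(𝒳_s(ℂ); ℂ) = 0` (`subsingleton_complexBetti`), so the
lift `η := 0` serves every edge (engine `exists_algebraic_lift_of_fibreClassLefschetzOn`, case split on `p ≤ d`).

## Content (every edge/row of parts V and VII, for the repaired nodes; NO named fact beyond `h₂₁`/`h₂₂` where shown)

* §E `not_fibreClassLefschetzFor`, `not_fibreClassLefschetzCompactPencils_of_pencil`,
  `not_fibreClassLefschetzCMPointedPencils_of_pencil`, `not_fibreClassLefschetzAtRelDim_of_pencil`,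
  `not_cmAnchoredPencilFibreClassLefschetz_of_class` — the refutations (each modulo an exhibited pencil / class).
* §A′ repaired nodes: `FibreClassLefschetzOn hf`; (β∀′) `FibreClassLefschetzOnCompactPencils`; (β′)
  `FibreClassLefschetzOnCMPointedPencils`; (β∃′) `CMAnchoredPencilFibreClassLefschetzOn`; (β′)_d
  `FibreClassLefschetzOnAtRelDim d`; the refuted nodes imply the repaired ones (`…On_of_…For`), so parts V–VII are
  superseded, not contradicted.
* §B′ engine and edges: (β∀′) ⟹ (L∀); (β′) ⟹ (L), (3), (4); (β∀′) ⟹ (2); (β′) ⟹[6.3.1] (β∃′) ⟹ (T∃); (β′)_d ⟹ (4)_d.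
* §C′ rows: `HC_CM ∧ (β′) ⟹ HC_AV` K[6.3.1]; `HC_CM ∧ (β∃′) ⟹ HC_AV` (no fact); KIND-1 `(β∀′) ⟹ HC_CM` K[J],
  `(β∀′) ⟹ HC_AV` K[6.3.1, J]; Frame rows; the Weil rows of part VII: `HC_CM ∧ (W)ₙ ∧ (β′)_{2n} ⟹ R∞`,
  **`HC_CM ∧ (W)₃ ∧ (β′)_6 ⟹ WeilSixfolds`**.
* Print pedigree / KIND / what is NOT claimed: verbatim as in part V's module docstring with (β) read as (β′):
  `(5) ⟹ (β′)` print-only (André Thm. 0.4 + Prop. 3.3 + §2.1; Kleiman/Jannsen), `HodgeConjecture ⟹ (β′)` and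
  `HC_AV ⟹ (β′)` not claimed; (β∀′) KIND 1 in the kernel, (β′) KIND 1 in print and `HC_CM`-load-bearing in the
  kernel, (β∃′) KIND 2.

References: Abdulali1994FamiliesAV (Conj. 5.3, Thm. 5.5, p. 1130; Lemma 6.2); Andre1996Motifs (Thm. 0.4, §2.1, Prop. 3.3,
Lemme 6.3.1, Remarque 2); Milne2020HodgeClassesAV (Prop. 1, Rem. 3); VoisinHodgeII2003 ((10.7), Prop. 9.21);
HatcherAT2002 (Thm. 3.26 (c): vanishing above the top degree).
-/

noncomputable section

set_option linter.dupNamespace false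

namespace Summit.HodgeConjecture.HodgeConjecture.Ring2.AbelianAll

open CategoryTheory AlgebraicGeometry
open Literature.AlgebraicGeometry Literature.AlgebraicGeometry.Motives
open Literature.AlgebraicGeometry.HodgeTheory
open Literature.AlgebraicGeometry.Milne1999 (IsOfCMType)
open Literature.AlgebraicGeometry.Abdulali1994 (InvariantCyclesHoldFor)
open Literature.AlgebraicGeometry.Andre1996 (andre1996_cmAnchoredPencil
  andre1996_cmHodgeClasses_algebraicallyAnchoredPencils IsCMAnchoredPencilFor)
open Literature.AlgebraicGeometry.Deligne1982 (cmLocus)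
open Summit.HodgeConjecture.HodgeConjecture
open Summit.HodgeConjecture.HodgeConjecture.Theses
open Summit.HodgeConjecture.HodgeConjecture.Ring2.Deform (CompactAbelianPencilVHC
  HC_AV_of_andre1996_of_compactAbelianPencilVHC)
open Summit.HodgeConjecture.HodgeConjecture.WeilTypeLadder (WeilClassesImaginaryQuadratic
  weilSixfolds_iff_weilClassesOf)

variable {𝒳 S : SchemeOver ℂ}

/-! ## §E The refutations of part V's unbounded nodes (degree bookkeeping only) -/

/-- **REFUTED-MISSTATED (own node): part V's `FibreClassLefschetzFor hf` is false for EVERY compact pencil** —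
at `p = d + 2` an algebraic correspondence `H^{2(d+3)}(𝒳) → H^{2(d+2)}(𝒳)` of the `(d+1)`-fold `𝒳` would need
`q : ℕ` with `2(d+2) + q = 2(d+1)` (`IsAlgebraicCorrespondence`, clause `b + q = 2m`). Witness: `p := d + 2`;
repaired statement: `FibreClassLefschetzOn hf` (`p ≤ d`), which the witness misses. [folklore] -/
theorem not_fibreClassLefschetzFor {d : ℕ} {f : 𝒳 ⟶ S} (hf : IsCompactAbelianPencil f d) :
    ¬ FibreClassLefschetzFor hf := by
  intro h
  obtain ⟨T, ⟨μ, ν, -, -, e, q, hab, hq, γ, -, -⟩, -⟩ := h (d + 2)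
  omega

/-- (β∀) of part V is refuted by any compact abelian pencil. [folklore] -/
theorem not_fibreClassLefschetzCompactPencils_of_pencil {d : ℕ} {f : 𝒳 ⟶ S} (hf : IsCompactAbelianPencil f d) :
    ¬ FibreClassLefschetzCompactPencils :=
  fun h ↦ not_fibreClassLefschetzFor hf (h hf)

/-- (β) of part V is refuted by any CM-pointed compact abelian pencil. [folklore] -/
theorem not_fibreClassLefschetzCMPointedPencils_of_pencil {d : ℕ} {f : 𝒳 ⟶ S} (hf : IsCompactAbelianPencil f d)
    (hcm : (cmLocus f d).Nonempty) : ¬ FibreClassLefschetzCMPointedPencils :=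
  fun h ↦ not_fibreClassLefschetzFor hf (h hf hcm)

/-- (β)_d of part VII is refuted by any CM-pointed compact abelian pencil of relative dimension `d`. [folklore] -/
theorem not_fibreClassLefschetzAtRelDim_of_pencil {d : ℕ} {f : 𝒳 ⟶ S} (hf : IsCompactAbelianPencil f d)
    (hcm : (cmLocus f d).Nonempty) : ¬ FibreClassLefschetzAtRelDim d :=
  fun h ↦ not_fibreClassLefschetzFor hf (h hf hcm)

/-- (β∃) of part V is refuted by any rational `(p,p)` class on any complex abelian variety. [folklore] -/
theorem not_cmAnchoredPencilFibreClassLefschetz_of_class (A : AbelianVariety ℂ) (hA : IsSmoothProjective A.dim A.X)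
    (p : ℕ) (c : complexBetti A.X (2 * p)) (hc : IsRationalClass c) (hpp : IsOfHodgeType A.dim A.X (2 * p) p p c) :
    ¬ CMAnchoredPencilFibreClassLefschetz := by
  intro h
  obtain ⟨𝒳, S, f, hf, hF⟩ := h A hA p c hc hpp
  exact not_fibreClassLefschetzFor hf.1 hF

/-! ## §A′ The repaired nodes: degrees `p ≤ d` -/

/-- **β-Lefschetz for ONE compact pencil, REPAIRED** (`hf : IsCompactAbelianPencil f d`): for every degree `p ≤ d`
(the degrees in which the `d`-dimensional fibres have cohomology `H^{2p}`) there is a linear map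
`T : H^{2(p+1)}(𝒳(ℂ); ℂ) → H^{2p}(𝒳(ℂ); ℂ)` induced by an algebraic class on `𝒳 × 𝒳`
(`IsAlgebraicCorrespondence (d+1) (d+1) 𝒳 𝒳 T`) inverting cup-with-the-fibre-class on fibre restrictions:
`j_s^*(T(j_{t*} j_t^* W)) = j_s^* W` for all global `W` and all `s, t`. Typed rendering of Abdulali's Conjecture
5.3 / the base half of `B(𝒳)`; implied in print by `B(𝒳)`; holds with `T` motivated unconditionally (part V
module docstring). OPEN; a HYPOTHESIS wherever used. Supersedes `FibreClassLefschetzFor` (refuted: no degree bound).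
[cite: Abdulali1994FamiliesAV, (5.1)–(5.2), Conjecture 5.3 and Theorem 5.5 (p. 1130)]
[cite: Andre1996Motifs, Thm. 0.4 (p. 8), §2.1 (p. 14) and Prop. 3.3 (p. 21)] -/
@[conjecture] def FibreClassLefschetzOn {d : ℕ} {f : 𝒳 ⟶ S} (hf : IsCompactAbelianPencil f d) : Prop :=
  ∀ p : ℕ, p ≤ d → ∃ T : complexBetti 𝒳 (2 * (p + 1)) →ₗ[ℂ] complexBetti 𝒳 (2 * p),
    IsAlgebraicCorrespondence (d + 1) (d + 1) 𝒳 𝒳 T ∧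
      ∀ (W : complexBetti 𝒳 (2 * p)) (t s : ComplexPoints S),
        complexBetti.map (fiberι f s) (2 * p) (T (fiberGysin hf t p (complexBetti.map (fiberι f t) (2 * p) W))) =
          complexBetti.map (fiberι f s) (2 * p) W

/-- **(β∀′) `FibreClassLefschetzOnCompactPencils`** — repaired β-Lefschetz for EVERY compact pencil of abelian
varieties. OPEN; a HYPOTHESIS wherever used; KIND 1 in the kernel. [cite: Andre1996Motifs, Remarque 2 (p. 33)]
[cite: Abdulali1994FamiliesAV, Conjecture 5.3 (p. 1130)] -/
@[conjecture] def FibreClassLefschetzOnCompactPencils : Prop :=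
  ∀ ⦃d : ℕ⦄ ⦃𝒳 S : SchemeOver ℂ⦄ ⦃f : 𝒳 ⟶ S⦄ (hf : IsCompactAbelianPencil f d), FibreClassLefschetzOn hf

/-- **(β′) `FibreClassLefschetzOnCMPointedPencils`** — repaired β-Lefschetz for the compact pencils of abelian
varieties HAVING A CM FIBRE: the Lefschetz-type `B_min` of the André axis. OPEN; a HYPOTHESIS wherever used;
KIND 1 in print, `HC_CM`-load-bearing in the kernel. [cite: Andre1996Motifs, Lemme 6.3.1 (p. 31) and Remarque 2 (p. 33)]
[cite: Abdulali1994FamiliesAV, Conjecture 5.3 and Main Theorem 6.1 (b) (pp. 1130–1131)] -/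
@[conjecture] def FibreClassLefschetzOnCMPointedPencils : Prop :=
  ∀ ⦃d : ℕ⦄ ⦃𝒳 S : SchemeOver ℂ⦄ ⦃f : 𝒳 ⟶ S⦄ (hf : IsCompactAbelianPencil f d), (cmLocus f d).Nonempty →
    FibreClassLefschetzOn hf

/-- **(β∃′) `CMAnchoredPencilFibreClassLefschetzOn`** — per Hodge class, SOME CM-anchored compact pencil of
Lemme 6.3.1 satisfying the repaired β-Lefschetz. OPEN; a HYPOTHESIS wherever used; KIND 2.
[cite: Andre1996Motifs, Lemme 6.3.1 (p. 31)] [cite: Abdulali1994FamiliesAV, Conjecture 5.3 (p. 1130) and Lemma 6.2 (p. 1131)] -/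
@[conjecture] def CMAnchoredPencilFibreClassLefschetzOn : Prop :=
  ∀ (A : AbelianVariety ℂ), IsSmoothProjective A.dim A.X →
    ∀ (p : ℕ) (c : complexBetti A.X (2 * p)), IsRationalClass c → IsOfHodgeType A.dim A.X (2 * p) p p c →
      ∃ (𝒳 S : SchemeOver ℂ) (f : 𝒳 ⟶ S) (hf : IsCMAnchoredPencilFor A p c f), FibreClassLefschetzOn hf.1

/-- **(β′)_d `FibreClassLefschetzOnAtRelDim d`** — (β′) on compact pencils of relative dimension `d` only.
OPEN; a HYPOTHESIS wherever used. [cite: Abdulali1994FamiliesAV, Conjecture 5.3 (p. 1130)] -/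
@[conjecture] def FibreClassLefschetzOnAtRelDim (d : ℕ) : Prop :=
  ∀ ⦃𝒳 S : SchemeOver ℂ⦄ ⦃f : 𝒳 ⟶ S⦄ (hf : IsCompactAbelianPencil f d), (cmLocus f d).Nonempty →
    FibreClassLefschetzOn hf

/-- The refuted node implies the repaired one (so parts V–VII are superseded, not contradicted). [folklore] -/
theorem fibreClassLefschetzOn_of_for {d : ℕ} {f : 𝒳 ⟶ S} (hf : IsCompactAbelianPencil f d)
    (h : FibreClassLefschetzFor hf) : FibreClassLefschetzOn hf :=
  fun p _ ↦ h p

/-- (β∀′) ⟹ (β′). [folklore] -/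
theorem fibreClassLefschetzOnCMPointedPencils_of_compactPencils (h : FibreClassLefschetzOnCompactPencils) :
    FibreClassLefschetzOnCMPointedPencils :=
  fun _ _ _ _ hf _ ↦ h hf

/-- (β′) is the conjunction of its graded pieces. [folklore] -/
theorem fibreClassLefschetzOnCMPointedPencils_iff_forall_atRelDim :
    FibreClassLefschetzOnCMPointedPencils ↔ ∀ d : ℕ, FibreClassLefschetzOnAtRelDim d :=
  ⟨fun h _ _ _ _ hf hcm ↦ h hf hcm, fun h _ _ _ _ hf hcm ↦ h _ hf hcm⟩

/-- **(β′) ∧ Lemme 6.3.1 ⟹ (β∃′)**. [cite: Andre1996Motifs, Lemme 6.3.1 (p. 31)] -/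
theorem cmAnchoredPencilFibreClassLefschetzOn_of_andre1996_of_cmPointed (h₂₁ : andre1996_cmAnchoredPencil)
    (h : FibreClassLefschetzOnCMPointedPencils) : CMAnchoredPencilFibreClassLefschetzOn := by
  intro A hA p c hc hpp
  obtain ⟨𝒳, S, f, hf⟩ := h₂₁ A hA p c hc hpp
  obtain ⟨-, -, t, -, -, A₀, -, -, -, -, -, -, ⟨e₀⟩, hA₀⟩ := id hf
  exact ⟨𝒳, S, f, hf, h hf.1 ⟨t, mem_cmLocus_of_compactPencil hf.1 e₀ hA₀⟩⟩

/-! ## §B′ Engine and kernel edges for the repaired nodes -/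

/-- **Engine (repaired).** On a compact pencil satisfying `FibreClassLefschetzOn`, a global class `W ∈ H^{2p}(𝒳)`
whose restriction to one fibre `𝒳_{s₀}` is algebraic agrees on EVERY fibre with a global ALGEBRAIC class: for
`p ≤ d`, `η := T(j_{s₀*} j_{s₀}^* W)` (part V's toolkit: `fiberGysin_mem_algebraicClasses`,
`map_mem_algebraicClasses_of_isAlgebraicCorrespondence`); for `p > d` the fibres have no cohomology in degree
`2p` (`subsingleton_complexBetti`) and `η := 0` serves. [cite: Abdulali1994FamiliesAV, Theorem 5.5 (p. 1130)]
[cite: HatcherAT2002, §3.3 Thm. 3.26 (c)] -/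
theorem exists_algebraic_lift_of_fibreClassLefschetzOn {d : ℕ} {f : 𝒳 ⟶ S} (hf : IsCompactAbelianPencil f d)
    (hF : FibreClassLefschetzOn hf) {p : ℕ} (W : complexBetti 𝒳 (2 * p)) {s₀ : ComplexPoints S}
    (h₀ : complexBetti.map (fiberι f s₀) (2 * p) W ∈ algebraicClasses (fiberOver f s₀) p) :
    ∃ η ∈ algebraicClasses 𝒳 p, ∀ s : ComplexPoints S,
      complexBetti.map (fiberι f s) (2 * p) η = complexBetti.map (fiberι f s) (2 * p) W := by
  by_cases hp : p ≤ d
  · obtain ⟨T, hT, hTW⟩ := hF p hp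
    exact ⟨T (fiberGysin hf s₀ p (complexBetti.map (fiberι f s₀) (2 * p) W)),
      map_mem_algebraicClasses_of_isAlgebraicCorrespondence hf.isSmoothProjective_total hf.isSmoothProjective_total
        hT (fiberGysin_mem_algebraicClasses hf s₀ h₀),
      fun s ↦ hTW W s₀ s⟩
  · refine ⟨0, Submodule.zero_mem _, fun s ↦ ?_⟩
    haveI := subsingleton_complexBetti (hf.isSmoothProjective_fiberOver s) (show 2 * d < 2 * p by omega)
    exact Subsingleton.elim _ _

/-- Transport of algebraicity on a compact pencil satisfying the repaired β-Lefschetz.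
[cite: Abdulali1994FamiliesAV, (1.1) (p. 1122) and Theorem 5.5 (p. 1130)] -/
theorem invariantCyclesHoldFor_of_fibreClassLefschetzOn {d : ℕ} {f : 𝒳 ⟶ S} (hf : IsCompactAbelianPencil f d)
    (hF : FibreClassLefschetzOn hf) : InvariantCyclesHoldFor f d := by
  rintro p W - ⟨s₀, h₀⟩ s
  obtain ⟨η, hη, hηs⟩ := exists_algebraic_lift_of_fibreClassLefschetzOn hf hF W h₀
  exact map_fiberι_mem_algebraicClasses_of_lift hf hη (hηs s) s

/-- **(β∀′) ⟹ (L∀)**. [cite: Abdulali1994FamiliesAV, Theorem 5.5 (p. 1130)] -/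
theorem algebraicFixedPart_of_fibreClassLefschetzOnCompactPencils (h : FibreClassLefschetzOnCompactPencils) :
    AlgebraicFixedPart := by
  intro d 𝒳 S f hf p W _ s₀ h₀
  obtain ⟨η, hη, hηs⟩ := exists_algebraic_lift_of_fibreClassLefschetzOn hf (h hf) W h₀
  exact ⟨η, hη, hηs s₀⟩

/-- **(β′) ⟹ (L)**. [cite: Abdulali1994FamiliesAV, Theorem 5.5 (p. 1130)] -/
theorem cmFibreAlgebraicLift_of_fibreClassLefschetzOnCMPointedPencils (h : FibreClassLefschetzOnCMPointedPencils) :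
    CMFibreAlgebraicLift := by
  intro d 𝒳 S f hf p W _ t ht h₀
  obtain ⟨η, hη, hηs⟩ := exists_algebraic_lift_of_fibreClassLefschetzOn hf (h hf ⟨t, ht⟩) W h₀
  exact ⟨η, hη, hηs t⟩

/-- **(β′) ⟹ (3)**. [cite: Abdulali1994FamiliesAV, (1.1) and p. 1122] -/
theorem cmPointedPencilVHC_of_fibreClassLefschetzOnCMPointedPencils (h : FibreClassLefschetzOnCMPointedPencils) :
    CMPointedPencilVHC :=
  fun _ _ _ _ hf hcm ↦ invariantCyclesHoldFor_of_fibreClassLefschetzOn hf (h hf hcm)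

/-- **(β∀′) ⟹ (2)**. [cite: Milne2020HodgeClassesAV, Thm. 4 and Prop. 1 (pp. 7–8)] -/
theorem compactAbelianPencilVHC_of_fibreClassLefschetzOnCompactPencils (h : FibreClassLefschetzOnCompactPencils) :
    CompactAbelianPencilVHC :=
  fun _ _ _ _ hf ↦ invariantCyclesHoldFor_of_fibreClassLefschetzOn hf (h hf)

/-- **(β′) ⟹ (4)**. [cite: Andre1996Motifs, §6.3 a) (p. 33)] -/
theorem cmAnchoredTransport_of_fibreClassLefschetzOnCMPointedPencils (h : FibreClassLefschetzOnCMPointedPencils) :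
    CMAnchoredTransport :=
  cmAnchoredTransport_of_cmFibreAlgebraicLift (cmFibreAlgebraicLift_of_fibreClassLefschetzOnCMPointedPencils h)

/-- **(β′)_d ⟹ (4)_d** (graded). [cite: Abdulali1994FamiliesAV, Theorem 5.5 (p. 1130)] -/
theorem cmAnchoredTransportAtRelDim_of_fibreClassLefschetzOnAtRelDim {d : ℕ} (h : FibreClassLefschetzOnAtRelDim d) :
    CMAnchoredTransportAtRelDim d := by
  intro 𝒳 S f hf p W _ t ht h₀ s
  obtain ⟨η, hη, hηs⟩ := exists_algebraic_lift_of_fibreClassLefschetzOn hf (h hf ⟨t, ht⟩) W h₀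
  exact map_fiberι_mem_algebraicClasses_of_lift hf hη (hηs s) s

/-- **(β∃′) ⟹ (T∃)**. [cite: Andre1996Motifs, Lemme 6.3.1 (p. 31) and §6.3 a) (p. 33)] -/
theorem cmAnchoredPencilTransport_of_cmAnchoredPencilFibreClassLefschetzOn
    (h : CMAnchoredPencilFibreClassLefschetzOn) : CMAnchoredPencilTransport := by
  intro A hA p c hc hpp
  obtain ⟨𝒳, S, f, hf, hF⟩ := h A hA p c hc hpp
  exact ⟨𝒳, S, f, hf, fun p' W hW t _ h₀ s ↦
    invariantCyclesHoldFor_of_fibreClassLefschetzOn hf.1 hF p' W hW ⟨t, h₀⟩ s⟩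

/-! ## §C′ The rows for the repaired nodes -/

/-- **`HC_CM → (β′) → HC_AV`, modulo Lemme 6.3.1 only** — the Lefschetz-flavoured deliverable of the André axis
(the Abdulali/Milne transport fact is not an input). research route, not a corollary; conditional on HC_CM plus
one named minimal statement. [cite: Andre1996Motifs, Lemme 6.3.1 (p. 31) and §6.3 a) (p. 33)]
[cite: Abdulali1994FamiliesAV, Conjecture 5.3, Theorem 5.5 and Lemma 6.2 (pp. 1130–1131)] -/
theorem HC_AV_of_HC_CM_and_fibreClassLefschetzOnCMPointedPencils (h₂₁ : andre1996_cmAnchoredPencil)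
    (hCM : RankFourFaces.CMAbelianHodge) (hF : FibreClassLefschetzOnCMPointedPencils) :
    PadicSemiregularLift.HodgeAbelianVarieties :=
  HC_AV_of_HC_CM_and_cmFibreAlgebraicLift h₂₁ hCM (cmFibreAlgebraicLift_of_fibreClassLefschetzOnCMPointedPencils hF)

/-- **`HC_CM ∧ (β∃′) ⟹ HC_AV` — NO named fact.** [cite: Andre1996Motifs, §6.3 a) (p. 33)] -/
theorem HC_AV_of_HC_CM_and_cmAnchoredPencilFibreClassLefschetzOn (hCM : RankFourFaces.CMAbelianHodge)
    (hF : CMAnchoredPencilFibreClassLefschetzOn) : PadicSemiregularLift.HodgeAbelianVarieties :=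
  HC_AV_of_HC_CM_and_cmAnchoredPencilTransport hCM
    (cmAnchoredPencilTransport_of_cmAnchoredPencilFibreClassLefschetzOn hF)

/-- KIND-1 witness for (β∀′): granted Lemmes 6.3.2–6.3.3, `(β∀′) ⟹ HC_CM`. [cite: Andre1996Motifs, Lemmes 6.3.2–6.3.3 (pp. 32–33)] -/
theorem HC_CM_of_andre1996_of_fibreClassLefschetzOnCompactPencils
    (h₂₂ : andre1996_cmHodgeClasses_algebraicallyAnchoredPencils) (hF : FibreClassLefschetzOnCompactPencils) :
    RankFourFaces.CMAbelianHodge :=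
  HC_CM_of_andre1996_of_algebraicFixedPart h₂₂ (algebraicFixedPart_of_fibreClassLefschetzOnCompactPencils hF)

/-- `(β∀′) ⟹ HC_AV` with NO `HC_CM`, modulo Lemmes 6.3.1–6.3.3. [cite: Andre1996Motifs, Remarque 2 (p. 33)] -/
theorem HC_AV_of_andre1996_of_fibreClassLefschetzOnCompactPencils (h₂₁ : andre1996_cmAnchoredPencil)
    (h₂₂ : andre1996_cmHodgeClasses_algebraicallyAnchoredPencils) (hF : FibreClassLefschetzOnCompactPencils) :
    PadicSemiregularLift.HodgeAbelianVarieties :=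
  HC_AV_of_andre1996_of_compactAbelianPencilVHC h₂₁ h₂₂
    (compactAbelianPencilVHC_of_fibreClassLefschetzOnCompactPencils hF)

/-- Frame: (β′) is a SUFFICIENT complement of `HC_CM` modulo Lemme 6.3.1 (`OnPathAV` not claimed).
[cite: Andre1996Motifs, Lemme 6.3.1 (p. 31)] -/
theorem closesWithCM_fibreClassLefschetzOnCMPointedPencils_of_andre1996 (h₂₁ : andre1996_cmAnchoredPencil) :
    ClosesWithCM FibreClassLefschetzOnCMPointedPencils :=
  fun hCM hF ↦ HC_AV_of_HC_CM_and_fibreClassLefschetzOnCMPointedPencils h₂₁ hCM hF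

/-- Frame: (β∃′) is a sufficient complement of `HC_CM`, no named fact. [cite: Andre1996Motifs, §6.3 a) (p. 33)] -/
theorem closesWithCM_cmAnchoredPencilFibreClassLefschetzOn : ClosesWithCM CMAnchoredPencilFibreClassLefschetzOn :=
  fun hCM hF ↦ HC_AV_of_HC_CM_and_cmAnchoredPencilFibreClassLefschetzOn hCM hF

/-- Frame: (β∀′) makes `HC_CM` idle, modulo Lemmes 6.3.1–6.3.3. [cite: Andre1996Motifs, Remarque 2 (p. 33)] -/
theorem cmIdle_fibreClassLefschetzOnCompactPencils_of_andre1996 (h₂₁ : andre1996_cmAnchoredPencil)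
    (h₂₂ : andre1996_cmHodgeClasses_algebraicallyAnchoredPencils) : CMIdle FibreClassLefschetzOnCompactPencils :=
  fun hF ↦ HC_AV_of_andre1996_of_fibreClassLefschetzOnCompactPencils h₂₁ h₂₂ hF

/-- `CMToAbelian` (stmt-16267, OPEN) from (β′), modulo Lemme 6.3.1. [cite: Andre1996Motifs, Lemme 6.3.1 (p. 31)] -/
theorem cmToAbelian_of_andre1996_of_fibreClassLefschetzOnCMPointedPencils (h₂₁ : andre1996_cmAnchoredPencil)
    (hF : FibreClassLefschetzOnCMPointedPencils) : RankFourFaces.CMToAbelian :=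
  cmToAbelian_of_closesWithCM (closesWithCM_fibreClassLefschetzOnCMPointedPencils_of_andre1996 h₂₁) hF

/-- **Weil's question (R∞) from `HC_CM`, compact Weil pencils and the repaired graded node at relative dimension
`2n`**, NO named fact. [cite: Weil1977HodgeRing] [cite: Abdulali1994FamiliesAV, Conjecture 5.3 (p. 1130)] -/
theorem HC_weilClassesImaginaryQuadratic_of_HC_CM_of_weilPencils_of_fibreClassLefschetzOn
    (hCM : RankFourFaces.CMAbelianHodge) (hW : ∀ n, 2 ≤ n → CMAnchoredCompactWeilPencilsAt n)
    (hF : ∀ n, 2 ≤ n → FibreClassLefschetzOnAtRelDim (2 * n)) : WeilClassesImaginaryQuadratic :=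
  HC_weilClassesImaginaryQuadratic_of_HC_CM_of_weilPencils_of_transport hCM hW
    fun n hn ↦ cmAnchoredTransportAtRelDim_of_fibreClassLefschetzOnAtRelDim (hF n hn)

/-- **THE SMALLEST OPEN INSTANCE, repaired: `HC_CM ∧ (W)₃ ∧ FibreClassLefschetzOnAtRelDim 6 ⟹ WeilSixfolds`**
(stmt-HodgeConjecture-2524; one algebraic correspondence, in each degree `p ≤ 6` — `p = 3` is the one used for
`W₆` — on the 14-fold `𝒳 × 𝒳` of each CM-pointed compact Weil-sixfold pencil `𝒳⁷ → C`). Nothing is closed.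
research route, not a corollary; conditional on HC_CM plus one named minimal statement.
[cite: Abdulali1994FamiliesAV, Conjecture 5.3 (p. 1130)] [cite: Andre1996Motifs, Remarque 2 (p. 33)] -/
theorem HC_weilSixfolds_of_HC_CM_of_weilPencilsAt_of_fibreClassLefschetzOnAtRelDim_six
    (hCM : RankFourFaces.CMAbelianHodge) (hW : CMAnchoredCompactWeilPencilsAt 3)
    (hF : FibreClassLefschetzOnAtRelDim 6) : Theses.SevenfoldWeilCensus.WeilSixfolds :=
  weilSixfolds_iff_weilClassesOf.2 fun _ hd _ _ hAdim hA hφ _ hcQ hcH hcW ↦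
    mem_algebraicClasses_of_HC_CM_of_weilPencilsAt_of_transport hCM hW
      (cmAnchoredTransportAtRelDim_of_fibreClassLefschetzOnAtRelDim hF) hd hAdim hA hφ hcQ hcH hcW

/-- **The repaired Lefschetz column in one statement**: (β∀′) ⟹ (β′) ⟹ (L) ⟹ (4), (β∀′) ⟹ (L∀) ⟹ (2),
(β′) ⟹ (3), (β′) ⟹[6.3.1] (β∃′) ⟹ (T∃). [cite: Andre1996Motifs, §6.3 (pp. 31–33)] -/
theorem fibreClassOn_chain (h₂₁ : andre1996_cmAnchoredPencil) :
    (FibreClassLefschetzOnCompactPencils → FibreClassLefschetzOnCMPointedPencils) ∧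
      (FibreClassLefschetzOnCMPointedPencils → CMFibreAlgebraicLift) ∧ (CMFibreAlgebraicLift → CMAnchoredTransport) ∧
      (FibreClassLefschetzOnCompactPencils → AlgebraicFixedPart) ∧ (AlgebraicFixedPart → CompactAbelianPencilVHC) ∧
      (FibreClassLefschetzOnCMPointedPencils → CMPointedPencilVHC) ∧
      (FibreClassLefschetzOnCMPointedPencils → CMAnchoredPencilFibreClassLefschetzOn) ∧
      (CMAnchoredPencilFibreClassLefschetzOn → CMAnchoredPencilTransport) :=
  ⟨fibreClassLefschetzOnCMPointedPencils_of_compactPencils, cmFibreAlgebraicLift_of_fibreClassLefschetzOnCMPointedPencils,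
    cmAnchoredTransport_of_cmFibreAlgebraicLift, algebraicFixedPart_of_fibreClassLefschetzOnCompactPencils,
    compactAbelianPencilVHC_of_algebraicFixedPart, cmPointedPencilVHC_of_fibreClassLefschetzOnCMPointedPencils,
    cmAnchoredPencilFibreClassLefschetzOn_of_andre1996_of_cmPointed h₂₁,
    cmAnchoredPencilTransport_of_cmAnchoredPencilFibreClassLefschetzOn⟩

end Summit.HodgeConjecture.HodgeConjecture.Ring2.AbelianAll

end
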